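import Literature.NumberTheory.Transcendental.RoyRankGenericMaps
import Literature.NumberTheory.Transcendental.RoyRankGenericApparatus
import HarnessLib

/-!
# Roy 1992 over a general field: the map `φ` of p. 35

Support file (everything proved, no facts) for the deduction of Roy's Theorem 4 from his Theorem 2
over the general data `(K, F, L)` of `Literature.NumberTheory.Transcendental.RoyRankGenericDefs`
([Roy1992], §4 pp. 35–37, in the generality of Remark (i), p. 37); field-generic form of the
`K = ℂ` companion `Literature.Barriers.Schanuel.AlgebraicIndependenceOfLogarithmsThm4FromThm2B`, whose
ring-generic pieces (`Roy1992.block`, `Roy1992.psi`, `psi_apply`, `incl_psi`) are reused by import.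
With an intermediate field `k ⊆ F` of finite degree over `ℚ` and a basis `η₁, …, η_m` of `k` over `ℚ`
(p. 35: "Let `η₁, …, η_m` be a basis of `k` over `ℚ`. Consider the surjective `K`-linear mapping
`φ : K^d × (K^d)^m → K^d`, `(x, (y₁, …, y_m)) ↦ x + η₁y₁ + ⋯ + η_my_m`. It gives by restriction a
surjective `ℚ`-linear mapping from `k^d × (L^d)^m` to `(k + k·L)^d`. We put … `W = φ⁻¹(0)`"), on the
space `LinTangent K d (m·d) = K^d × K^{md}` (the factor `(K^d)^m` flattened by `finProdFinEquiv`):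

* `RoyRank.psi_incl_eq_zero` — `ψ_η : y ↦ ∑ η_μ y_μ` is injective on `ℚ^{md}` ("`φ` induces by
  restriction a `ℚ`-linear isomorphism from `0 × (ℚ^d)^m` to `k^d`", p. 36).
* for the map `φ` (`RoyRank.phi η` of `…RoyRankGenericApparatus`): `phi_surjective`,
  `finrank_ker_phi` (`= md`, used as "`d + md − dim_K(W) = d`", p. 37) and `isFRational_ker_phi`
  (`W = ker φ` is rational over `F`, a hypothesis of Theorem 2; needs `k ⊆ F`).
* `RoyRank.exists_expansion` — every element of `k + k·L = span_k ({1} ∪ L)` is `x + ∑ η_μ y_μ` with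
  `x ∈ k`, `y_μ ∈ L` (the surjectivity of `φ : k^d × (L^d)^m → (k + k·L)^d`), and its vector form
  `RoyRank.exists_phi_preimage`.
* `RoyRank.linearIndependent_eta_smul` — for an `F`-independent family `z_r` of `K^d`, the family
  `η_μ z_r` is `ℚ`-independent (the count "`dim_ℚ(Y) ≥ dim_ℚ(Z₁) = m dim_k(Z₁) ≥ m dim_ℚ̄(Z)`", p. 37).

## References

* [Roy1992] D. Roy, *Matrices whose coefficients are linear forms in logarithms*, J. Number Theory
  41 (1992) 22–47: §4, proof of Theorem 4, pp. 35–37; Remark (i), p. 37.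
-/

noncomputable section

open Module Submodule
open Literature.Barriers.Schanuel.Roy1992 (incl incl_apply block psi psi_apply incl_psi)

namespace Literature.NumberTheory.Transcendental.RoyRank

variable {K : Type*} [Field K] [CharZero K]
variable {d m : ℕ}

/-! ### `ψ` with coordinates in a subfield; injectivity on rational vectors -/

/-- `ψ_e y` has coordinates in an intermediate field containing the `e_μ` and the coordinates of `y`.
[folklore] -/
theorem psi_mem (S : IntermediateField ℚ K) {e : Fin m → K} (he : ∀ μ, e μ ∈ S)
    {y : Fin (m * d) → K} (hy : ∀ j, y j ∈ S) (i : Fin d) : psi e y i ∈ S := by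
  rw [psi_apply]
  exact sum_mem fun μ _ => mul_mem (he μ) (hy _)

variable {k : IntermediateField ℚ K} (η : Basis (Fin m) ℚ k)

/-- **`ψ_η` is injective on `ℚ^{md}`** ("`φ` induces by restriction a `ℚ`-linear isomorphism from
`0 × (ℚ^d)^m` to `k^d`"): if `∑_μ η_μ y_μ = 0` with rational `y_μ` then `y = 0`.
[cite: Roy1992, §4 proof of Theorem 4 (p. 36)] -/
theorem psi_incl_eq_zero {y : Fin (m * d) → ℚ}
    (hy : psi (fun μ => (η μ : k)) (incl ℚ k (m * d) y) = 0) : y = 0 := by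
  have hcoord : ∀ i : Fin d, ∀ μ : Fin m, y (finProdFinEquiv (μ, i)) = 0 := by
    intro i
    have hi := congrFun hy i
    rw [psi_apply, Pi.zero_apply] at hi
    have hi' : ∑ μ, y (finProdFinEquiv (μ, i)) • η μ = 0 := by
      rw [← hi]
      refine Finset.sum_congr rfl fun μ _ => ?_
      rw [incl_apply, Algebra.smul_def, mul_comm]
    exact Fintype.linearIndependent_iff.1 η.linearIndependent _ hi'
  funext j
  obtain ⟨⟨μ, i⟩, rfl⟩ := finProdFinEquiv.surjective j
  exact hcoord i μ

/-! ### The map `φ` -/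

/-- `φ` is surjective (`φ(x, 0) = x`). [cite: Roy1992, §4 proof of Theorem 4 (p. 35)] -/
theorem phi_surjective : Function.Surjective (phi (d := d) η) :=
  fun x => ⟨(x, 0), by simp⟩

/-- `dim_K ker φ = md` (so that `d + md − dim_K(W) = d` for `W = ker φ`).
[cite: Roy1992, §4 proof of Theorem 4 (p. 37)] -/
theorem finrank_ker_phi : finrank K (LinearMap.ker (phi (d := d) η)) = m * d := by
  have h := LinearMap.finrank_range_add_finrank_ker (phi (d := d) η)
  rw [LinearMap.range_eq_top.2 (phi_surjective η), finrank_top, finrank_fin_fun, Module.finrank_prod,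
    finrank_fin_fun, finrank_fin_fun] at h
  omega

/-- `ker φ` is the range of the graph map. [folklore] -/
theorem ker_phi_eq_range : LinearMap.ker (phi (d := d) η) = LinearMap.range (kerGraph (d := d) η) := by
  ext q
  constructor
  · intro hq
    rw [LinearMap.mem_ker, phi_apply] at hq
    have h1 : q.1 = -(psi (fun μ => ((η μ : k) : K)) q.2) := eq_neg_of_add_eq_zero_left hq
    refine ⟨q.2, Prod.ext ?_ ?_⟩
    · rw [h1]; simp [kerGraph]
    · simp [kerGraph]
  · rintro ⟨y, rfl⟩
    rw [LinearMap.mem_ker, phi_apply]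
    simp [kerGraph]

/-- The `η_μ` lie in any intermediate field `F ⊇ k`. [folklore] -/
theorem eta_mem {F : IntermediateField ℚ K} (hkF : k ≤ F) (μ : Fin m) : ((η μ : k) : K) ∈ F :=
  hkF (η μ).2

/-- **`W = ker φ` is rational over `F ⊇ k`** (a hypothesis of Theorem 2 for the object
`(K^d × (K^d)^m, Y, W, V)` of p. 35): `ker φ` is spanned by the `F`-points `(−η_μ e_i, e_{(μ,i)})`.
[cite: Roy1992, §4 proof of Theorem 4 (p. 35)] -/
theorem isFRational_ker_phi {F : IntermediateField ℚ K} (hkF : k ≤ F) :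
    IsFRational F (LinearMap.ker (phi (d := d) η)) := by
  refine le_antisymm ?_ (Submodule.span_le.2 fun v hv => hv.1)
  rw [ker_phi_eq_range, LinearMap.range_eq_map, ← (Pi.basisFun K (Fin (m * d))).span_eq,
    Submodule.map_span]
  refine Submodule.span_mono ?_
  rintro _ ⟨_, ⟨j, rfl⟩, rfl⟩
  refine ⟨Submodule.subset_span ⟨_, ⟨j, rfl⟩, rfl⟩, ?_, ?_⟩
  · intro i
    simp only [kerGraph, LinearMap.prod_apply, Pi.basisFun_apply]
    refine neg_mem (psi_mem F (eta_mem η hkF) (fun j' => ?_) i)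
    by_cases h : j' = j
    · subst h; simp
    · simp [h]
  · intro j'
    simp only [kerGraph, LinearMap.prod_apply, LinearMap.id_coe, Pi.basisFun_apply]
    by_cases h : j' = j
    · subst h; simp
    · simp [h]

/-! ### `k + k·L = φ(k^d × (L^d)^m)`: the expansion `x + ∑ η_μ y_μ` -/

/-- Coordinates in the basis `η`, pushed to `K`: `c = ∑_ν (η.repr c ν) · η_ν` in `K`. [folklore] -/
theorem coe_eq_sum_repr (c : k) :
    (c : K) = ∑ ν, algebraMap ℚ K (η.repr c ν) * ((η ν : k) : K) := by
  conv_lhs => rw [← η.sum_repr c]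
  rw [IntermediateField.coe_sum]
  refine Finset.sum_congr rfl fun ν _ => ?_
  rw [IntermediateField.coe_smul, Algebra.smul_def]

/-- **The expansion lemma** (surjectivity of `φ : k^d × (L^d)^m → (k + k·L)^d`, coordinatewise):
every element of `k + k·L = span_k ({1} ∪ L)` can be written `x + ∑_μ η_μ y_μ` with `x ∈ k` and
`y_μ ∈ L` (`L` a `ℚ`-subspace of `K`). [cite: Roy1992, §4 proof of Theorem 4 (p. 35)] -/
theorem exists_expansion (L : Submodule ℚ K) {c : K}
    (hc : c ∈ Submodule.span k ({1} ∪ (L : Set K))) :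
    ∃ (x : k) (y : Fin m → K), (∀ μ, y μ ∈ L) ∧
      c = x + ∑ μ, ((η μ : k) : K) * y μ := by
  induction hc using Submodule.span_induction with
  | mem c hc =>
    rcases hc with hc | hc
    · rw [Set.mem_singleton_iff] at hc
      subst hc
      exact ⟨1, 0, fun _ => zero_mem _, by simp⟩
    · -- `ℓ = ∑_μ η_μ (q_μ ℓ)` with `1 = ∑ q_μ η_μ`
      refine ⟨0, fun μ => algebraMap ℚ K (η.repr 1 μ) * c, fun μ => ?_, ?_⟩
      · show algebraMap ℚ K (η.repr 1 μ) * c ∈ L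
        rw [← Algebra.smul_def]
        exact L.smul_mem _ hc
      · have h1 := coe_eq_sum_repr η 1
        rw [IntermediateField.coe_one] at h1
        calc c = 1 * c := (one_mul c).symm
          _ = (∑ ν, algebraMap ℚ K (η.repr 1 ν) * ((η ν : k) : K)) * c := by rw [← h1]
          _ = _ := by rw [IntermediateField.coe_zero, zero_add, Finset.sum_mul]
                      exact Finset.sum_congr rfl fun μ _ => by ring
  | zero => exact ⟨0, 0, fun _ => zero_mem _, by simp⟩
  | add c c' _ _ hc hc' =>
    obtain ⟨x, y, hy, rfl⟩ := hc
    obtain ⟨x', y', hy', rfl⟩ := hc'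
    refine ⟨x + x', y + y', fun μ => add_mem (hy μ) (hy' μ), ?_⟩
    rw [IntermediateField.coe_add]
    simp only [Pi.add_apply, mul_add, Finset.sum_add_distrib]
    ring
  | smul a c _ hc =>
    obtain ⟨x, y, hy, rfl⟩ := hc
    -- `a η_μ = ∑_ν r_{μν} η_ν`, so `∑_μ a η_μ y_μ = ∑_ν η_ν (∑_μ r_{μν} y_μ)`
    refine ⟨a * x, fun ν => ∑ μ, algebraMap ℚ K (η.repr (a * η μ) ν) * y μ, fun ν => ?_, ?_⟩
    · refine sum_mem fun μ _ => ?_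
      rw [← Algebra.smul_def]
      exact L.smul_mem _ (hy μ)
    · rw [IntermediateField.smul_def, smul_eq_mul, IntermediateField.coe_mul, mul_add, Finset.mul_sum]
      congr 1
      calc ∑ μ, (a : K) * (((η μ : k) : K) * y μ)
          = ∑ μ, ((a * η μ : k) : K) * y μ := by
            refine Finset.sum_congr rfl fun μ _ => ?_
            rw [IntermediateField.coe_mul]; ring
        _ = ∑ μ, (∑ ν, algebraMap ℚ K (η.repr (a * η μ) ν) * ((η ν : k) : K)) * y μ := by
            refine Finset.sum_congr rfl fun μ _ => ?_
            rw [← coe_eq_sum_repr η (a * η μ)]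
        _ = ∑ ν, ((η ν : k) : K) * ∑ μ, algebraMap ℚ K (η.repr (a * η μ) ν) * y μ := by
            simp only [Finset.sum_mul, Finset.mul_sum]
            rw [Finset.sum_comm]
            refine Finset.sum_congr rfl fun ν _ => Finset.sum_congr rfl fun μ _ => ?_
            ring

/-- **Preimages under `φ`**: a vector of `(k + k·L)^d` is `φ(q)` for some `q ∈ k^d × (L^d)^m`
(coordinatewise expansion). [cite: Roy1992, §4 proof of Theorem 4 (p. 35)] -/
theorem exists_phi_preimage (L : Submodule ℚ K) {v : Fin d → K}
    (hv : ∀ i, v i ∈ Submodule.span k ({1} ∪ (L : Set K))) :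
    ∃ q : LinTangent K d (m * d), phi η q = v ∧ (∀ i, q.1 i ∈ k) ∧ ∀ j, q.2 j ∈ L := by
  choose x y hy hxy using fun i => exists_expansion η L (hv i)
  refine ⟨(fun i => (x i : K), fun j => y (finProdFinEquiv.symm j).2 (finProdFinEquiv.symm j).1),
    ?_, fun i => (x i).2, fun j => hy _ _⟩
  funext i
  rw [phi_apply, Pi.add_apply, psi_apply, hxy i]
  simp

/-! ### `ℚ`-independence of the `η_μ z_r` -/

/-- **The count `dim_ℚ Y ≥ m · dim_F Z`**: if `z₁, …, z_n ∈ K^d` are `F`-linearly independent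
(`F ⊇ k`) then the `mn` vectors `η_μ z_r` are `ℚ`-linearly independent (a `ℚ`-relation
`∑ q_{μr} η_μ z_r = 0` is an `F`-relation `∑_r (∑_μ q_{μr} η_μ) z_r = 0`, and `η` is a `ℚ`-basis of `k`).
[cite: Roy1992, §4 proof of Theorem 4 (p. 37)] -/
theorem linearIndependent_eta_smul {F : IntermediateField ℚ K} (hkF : k ≤ F) {n : ℕ}
    {z : Fin n → (Fin d → K)} (hz : LinearIndependent F z) :
    LinearIndependent ℚ (fun q : Fin m × Fin n => ((η q.1 : k) : K) • z q.2) := by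
  rw [Fintype.linearIndependent_iff]
  intro g hg
  -- the `F`-coefficients `c_r = ∑_μ g_{μ r} η_μ`
  have hcmem : ∀ r, ∑ μ, algebraMap ℚ K (g (μ, r)) * ((η μ : k) : K) ∈ F := fun r =>
    sum_mem fun μ _ => mul_mem (algebraMap_mem F (g (μ, r))) (eta_mem η hkF μ)
  let c : Fin n → F := fun r => ⟨_, hcmem r⟩
  have hrel : ∑ r, c r • z r = 0 := by
    rw [← hg, Fintype.sum_prod_type, Finset.sum_comm]
    refine Finset.sum_congr rfl fun r _ => ?_
    funext i
    simp only [Pi.smul_apply, IntermediateField.smul_def, smul_eq_mul, Finset.sum_apply,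
      Finset.sum_mul, c]
    refine Finset.sum_congr rfl fun μ _ => ?_
    rw [Algebra.smul_def]
    ring
  have hc0 : ∀ r, c r = 0 := Fintype.linearIndependent_iff.1 hz c hrel
  rintro ⟨μ, r⟩
  have hr : ∑ μ, g (μ, r) • η μ = 0 := by
    have h := congrArg (fun x : F => (x : K)) (hc0 r)
    simp only [c, ZeroMemClass.coe_zero] at h
    apply Subtype.val_injective
    rw [IntermediateField.coe_sum, ZeroMemClass.coe_zero, ← h]
    refine Finset.sum_congr rfl fun μ _ => ?_
    rw [IntermediateField.coe_smul, Algebra.smul_def]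
  exact Fintype.linearIndependent_iff.1 η.linearIndependent _ hr μ

end Literature.NumberTheory.Transcendental.RoyRank
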